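import Summits.QuantumFields.BalabanUV.Beta.WardLocusSecondOrder

/-!
# `BalabanUV.Beta.KernelWardCoarseExchange` — binder row D1, hW W-side (W-L4): EXCHANGE LEMMAS FOR COARSE SUPERPOSITIONS AND THE
# LINEARITY / CONJUGATION CALCULUS OF THE MULTIPLIER-COLUMN VERTEX `vertexOfM`

HONEST FRAMING (cell charter, verbatim): «discharging `BetaPertH` makes Bałaban's UV stability UNCONDITIONAL — a real constructive-QFT
result; it is NOT the continuum limit and NOT the Clay problem.»  DERIVED cell module (pub-balaban β sub-cell, lineage an1 «direct one-loop in
Bałaban's gauge», gen 27 — the hW root author's W-side bookkeeping lane, journal l.8696/l.8816/l.9007; planning document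
`HOME/b2b-balaban-beta-an1-g27/SKELETON-D1-L4-HW.v1.md` §2).  [folklore] kernel algebra over an2's `SecondOrderResponse` /
`InterLevelTransport` carriers (`vertexOfM`, `colM`, `cwsum`) BY NAME; 0 def, no statement of Bałaban's papers typed, no `[cite:]` tag;
pure bookkeeping — nothing of (W-L4) is discharged.  NOT `BetaPertH`, NOT continuum, NOT Clay.  Consumer: `Beta.KernelWardMixedLaw` (P2 of
the hW reduction under the table law (T2-M₂), and the assembled first-order half of `hWd`).
HONEST DEPENDENCY (cell records, verbatim): «continuum YM on T⁴ ⇐ BetaPertH ∧ nine spine estimates (0/9 proved); BetaPertH ⇐ (D1) ∧ (D4) ∧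
CAP+tail; G-an2-4 gates asym, D1 and NE2/3/4.»
ABSOLUTE RULE (cell charter, verbatim): «No internally-minted statement may enter as a cited fact. Every hypothesis is either kernel-proved in
this package or a verbatim quotation of a PUBLISHED theorem with page reference. The manuscript(s) under audit are NOT citable for their own
disputed steps — they are the thing under adjudication; programme-internal (2001/route/tribunal) claims are never citable.»

WHAT IS HERE.
* §1 EXCHANGE LEMMAS FOR COARSE SUPERPOSITIONS `cwsum N w Q = Σ'_v w_v Q_v` (absolutely summable coarse weights, uniformly bounded families)
  and for bounded kernels against a spread one: `abs_comp_le_of_spr_left/right` (`X ∘ A`, `A ∘ X` bounded), `comp_add_of_bdd`,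
  `add_comp_of_bdd`, `conjV_add_of_bdd` (additivity over bounded kernels), `trK_cwsum`, `abs_cwsum_le`, `cwsum_add`, `cwsum_sub`,
  `comp_cwsum`, `cwsum_comp` (the coarse twins of an1's `ChartConjugationReflection.comp_wsum`/`wsum_comp`: one Fubini exchange under a
  product bound, `KernelWard.tsum_comm_of_prodBound`).
* §2 THE MULTIPLIER-COLUMN VERTEX `vertexOfM K N M μ y = Σ_ρ cwsum N (colM K N μ y ρ) (M ρ)` IS LINEAR IN ITS TABLE (`vertexOfM_add`,
  `vertexOfM_neg`, `smul_vertexOfM`, `vertexOfM_congr`), THE BLOCK PURE-GAUGE CONTRACTION OF THE FIELD SLOT PASSES INSIDE IT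
  (`sum_divV_vertexOfM_eq`, the twin of leaf-10's `sum_divV_vertexOfK_eq`), and THE VERTEX OF A CONJUGATED MULTIPLIER-ROW FAMILY IS THE
  CONJUGATE OF THE VERTEX (`vertexOfM_conjV`, the twin of an1's `vertexOfK_conjV`; decaying `K`, spread `X`, bounded `M`).
-/

noncomputable section

open Finset
open scoped BigOperators
open Literature.MathematicalPhysics.QuantumFieldTheory
open Literature.MathematicalPhysics.QuantumFieldTheory.Balaban1983to89
open Literature.MathematicalPhysics.QuantumFieldTheory.Balaban1983to89.Beta
open B12Sec2to5 (l1)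
open B6BondElimination (unitVec)
open ExpKernelCalculus (MKer Decays comp summable_exp_shift summable_exp_shift' tsum_exp_shift tsum_exp_shift' Zl)
open KernelWard (divV)
open AffineAveraging (box toSite)
open OneStepResolventKernel (Fib wsum)
open InterLevelTransport (cwsum cwsum_apply onLat)
open SecondOrderResponse (colM vertexOfM)
open Summit.QuantumFields.BalabanUV.Beta.TameKernelCalculus
open Summit.QuantumFields.BalabanUV.Beta.ChartConjugation (conjV)
open Summit.QuantumFields.BalabanUV.Beta.WardLocusSecondOrder (summable_abs_colM)

namespace Summit.QuantumFields.BalabanUV.Beta.KernelWardCoarseExchange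

variable {d N : ℕ}

/-! ## §1 Exchange lemmas: coarse superpositions and bounded-against-spread compositions -/

section Exchange

/-- [folklore] A spread kernel composed on the LEFT of a uniformly bounded one is uniformly bounded:
`|X ∘ A| ≤ (#F · C · Zl δ) · B`. -/
theorem abs_comp_le_of_spr_left {X A : MKer (d + 1) (Fib d)} {C δ : ℝ} (hX : Decays X C δ) (hδ : 0 < δ) {B : ℝ}
    (hA : ∀ x z a b, |A x z a b| ≤ B) (x z : Fin (d + 1) → ℤ) (a b : Fib d) :
    |comp X A x z a b| ≤ (Fintype.card (Fib d) : ℝ) * C * Zl (d + 1) δ * B := by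
  have hB : 0 ≤ B := (abs_nonneg _).trans (hA x z a b)
  have hC : 0 ≤ C := hX.nonneg (Sum.inl 0)
  unfold ExpKernelCalculus.comp
  have hsw : Summable fun y => ∑ _f : Fib d, C * Real.exp (-δ * l1 (x - y)) * B :=
    summable_sum fun f _ => ((summable_exp_shift hδ x).mul_left C).mul_right B
  have hle : ∀ y, |∑ f, X x y a f * A y z f b| ≤ ∑ _f : Fib d, C * Real.exp (-δ * l1 (x - y)) * B := fun y =>
    (Finset.abs_sum_le_sum_abs _ _).trans (Finset.sum_le_sum fun f _ => by
      rw [abs_mul]; exact mul_le_mul (hX x y a f) (hA y z f b) (abs_nonneg _) (by positivity))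
  have hs : Summable fun y => ∑ f, X x y a f * A y z f b :=
    Summable.of_norm_bounded hsw (fun y => by rw [Real.norm_eq_abs]; exact hle y)
  calc |∑' y, ∑ f, X x y a f * A y z f b| ≤ ∑' y, |∑ f, X x y a f * A y z f b| := by
        rw [← Real.norm_eq_abs]; exact norm_tsum_le_tsum_norm hs.abs
    _ ≤ ∑' y, ∑ _f : Fib d, C * Real.exp (-δ * l1 (x - y)) * B := hs.abs.tsum_le_tsum hle hsw
    _ = (Fintype.card (Fib d) : ℝ) * C * Zl (d + 1) δ * B := by
        simp only [Finset.sum_const, Finset.card_univ, nsmul_eq_mul]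
        rw [tsum_mul_left, tsum_mul_right, tsum_mul_left, tsum_exp_shift]; ring

/-- [folklore] A spread kernel composed on the RIGHT of a uniformly bounded one is uniformly bounded:
`|A ∘ X| ≤ (#F · C · Zl δ) · B`. -/
theorem abs_comp_le_of_spr_right {X A : MKer (d + 1) (Fib d)} {C δ : ℝ} (hX : Decays X C δ) (hδ : 0 < δ) {B : ℝ}
    (hA : ∀ x z a b, |A x z a b| ≤ B) (x z : Fin (d + 1) → ℤ) (a b : Fib d) :
    |comp A X x z a b| ≤ (Fintype.card (Fib d) : ℝ) * C * Zl (d + 1) δ * B := by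
  have hB : 0 ≤ B := (abs_nonneg _).trans (hA x z a b)
  have hC : 0 ≤ C := hX.nonneg (Sum.inl 0)
  unfold ExpKernelCalculus.comp
  have hsw : Summable fun y => ∑ _f : Fib d, C * Real.exp (-δ * l1 (y - z)) * B :=
    summable_sum fun f _ => ((summable_exp_shift' hδ z).mul_left C).mul_right B
  have hle : ∀ y, |∑ f, A x y a f * X y z f b| ≤ ∑ _f : Fib d, C * Real.exp (-δ * l1 (y - z)) * B := fun y =>
    (Finset.abs_sum_le_sum_abs _ _).trans (Finset.sum_le_sum fun f _ => by
      rw [abs_mul, mul_comm]; exact mul_le_mul (hX y z f b) (hA x y a f) (abs_nonneg _) (by positivity))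
  have hs : Summable fun y => ∑ f, A x y a f * X y z f b :=
    Summable.of_norm_bounded hsw (fun y => by rw [Real.norm_eq_abs]; exact hle y)
  calc |∑' y, ∑ f, A x y a f * X y z f b| ≤ ∑' y, |∑ f, A x y a f * X y z f b| := by
        rw [← Real.norm_eq_abs]; exact norm_tsum_le_tsum_norm hs.abs
    _ ≤ ∑' y, ∑ _f : Fib d, C * Real.exp (-δ * l1 (y - z)) * B := hs.abs.tsum_le_tsum hle hsw
    _ = (Fintype.card (Fib d) : ℝ) * C * Zl (d + 1) δ * B := by
        simp only [Finset.sum_const, Finset.card_univ, nsmul_eq_mul]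
        rw [tsum_mul_left, tsum_mul_right, tsum_mul_left, tsum_exp_shift']; ring

/-- [folklore] A spread kernel distributes over a sum of uniformly bounded kernels on its right: `X ∘ (A + B) = X ∘ A + X ∘ B`. -/
theorem comp_add_of_bdd {X A B : MKer (d + 1) (Fib d)} (hX : Spr X) {BA BB : ℝ} (hA : ∀ x z a b, |A x z a b| ≤ BA)
    (hB : ∀ x z a b, |B x z a b| ≤ BB) : comp X (A + B) = comp X A + comp X B := by
  obtain ⟨C, δ, hδ, hXd⟩ := hX
  have hC : 0 ≤ C := hXd.nonneg (Sum.inl 0)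
  funext x z a b
  simp only [ExpKernelCalculus.comp, Pi.add_apply]
  have hs : ∀ (R : MKer (d + 1) (Fib d)) (BR : ℝ), (∀ x z a b, |R x z a b| ≤ BR) →
      Summable fun y => ∑ f, X x y a f * R y z f b := fun R BR hR => by
    have hBR : 0 ≤ BR := (abs_nonneg _).trans (hR x z a b)
    refine summable_sum fun f _ => Summable.of_norm_bounded (((summable_exp_shift hδ x).mul_left C).mul_right BR) (fun y => ?_)
    rw [Real.norm_eq_abs, abs_mul]
    exact mul_le_mul (hXd x y a f) (hR y z f b) (abs_nonneg _) (by positivity)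
  rw [← (hs A BA hA).tsum_add (hs B BB hB)]
  refine tsum_congr fun y => ?_
  rw [← Finset.sum_add_distrib]
  exact Finset.sum_congr rfl fun f _ => by ring

/-- [folklore] A spread kernel distributes over a sum of uniformly bounded kernels on its left: `(A + B) ∘ X = A ∘ X + B ∘ X`. -/
theorem add_comp_of_bdd {X A B : MKer (d + 1) (Fib d)} (hX : Spr X) {BA BB : ℝ} (hA : ∀ x z a b, |A x z a b| ≤ BA)
    (hB : ∀ x z a b, |B x z a b| ≤ BB) : comp (A + B) X = comp A X + comp B X := by
  obtain ⟨C, δ, hδ, hXd⟩ := hX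
  have hC : 0 ≤ C := hXd.nonneg (Sum.inl 0)
  funext x z a b
  simp only [ExpKernelCalculus.comp, Pi.add_apply]
  have hs : ∀ (R : MKer (d + 1) (Fib d)) (BR : ℝ), (∀ x z a b, |R x z a b| ≤ BR) →
      Summable fun y => ∑ f, R x y a f * X y z f b := fun R BR hR => by
    have hBR : 0 ≤ BR := (abs_nonneg _).trans (hR x z a b)
    refine summable_sum fun f _ => Summable.of_norm_bounded (((summable_exp_shift' hδ z).mul_left C).mul_right BR) (fun y => ?_)
    rw [Real.norm_eq_abs, abs_mul, mul_comm]
    exact mul_le_mul (hXd y z f b) (hR x y a f) (abs_nonneg _) (by positivity)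
  rw [← (hs A BA hA).tsum_add (hs B BB hB)]
  refine tsum_congr fun y => ?_
  rw [← Finset.sum_add_distrib]
  exact Finset.sum_congr rfl fun f _ => by ring

/-- [folklore] The relative conjugation `conjV X V := X ∘ V − V ∘ X` is additive in `V` over uniformly bounded kernels. -/
theorem conjV_add_of_bdd {X A B : MKer (d + 1) (Fib d)} (hX : Spr X) {BA BB : ℝ} (hA : ∀ x z a b, |A x z a b| ≤ BA)
    (hB : ∀ x z a b, |B x z a b| ≤ BB) : conjV X (A + B) = conjV X A + conjV X B := by
  unfold ChartConjugation.conjV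
  rw [comp_add_of_bdd hX hA hB, add_comp_of_bdd hX hA hB]
  abel

/-- [folklore] Transposition passes inside a coarse superposition (termwise). -/
theorem trK_cwsum (N : ℕ) (w : (Fin (d + 1) → ℤ) → ℝ) (Q : (Fin (d + 1) → ℤ) → MKer (d + 1) (Fib d)) :
    trK (cwsum N w Q) = cwsum N w (fun v => trK (Q v)) := by
  funext x z a b
  show cwsum N w Q z x b a = cwsum N w (fun v => trK (Q v)) x z a b
  simp only [InterLevelTransport.cwsum, OneStepResolventKernel.wsum]
  refine tsum_congr fun u => ?_
  unfold InterLevelTransport.onLat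
  split_ifs <;> rfl

variable [NeZero N]

/-- [folklore] A coarse superposition of a uniformly bounded family with absolutely summable weights is uniformly bounded:
`|cwsum N w Q| ≤ (Σ' |w|) · B`. -/
theorem abs_cwsum_le {w : (Fin (d + 1) → ℤ) → ℝ} (hw : Summable fun v => |w v|) {Q : (Fin (d + 1) → ℤ) → MKer (d + 1) (Fib d)}
    {B : ℝ} (hB : ∀ v x z a b, |Q v x z a b| ≤ B) (x z : Fin (d + 1) → ℤ) (a b : Fib d) :
    |cwsum N w Q x z a b| ≤ (∑' v, |w v|) * B := by
  rw [cwsum_apply]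
  have hs : Summable fun v => |w v| * B := hw.mul_right B
  have hle : ∀ v, |w v * Q v x z a b| ≤ |w v| * B := fun v => by
    rw [abs_mul]; exact mul_le_mul_of_nonneg_left (hB v x z a b) (abs_nonneg _)
  have hs' : Summable fun v => w v * Q v x z a b := Summable.of_norm_bounded hs (fun v => by rw [Real.norm_eq_abs]; exact hle v)
  calc |∑' v, w v * Q v x z a b| ≤ ∑' v, |w v * Q v x z a b| := by
        rw [← Real.norm_eq_abs]; exact norm_tsum_le_tsum_norm hs'.abs
    _ ≤ ∑' v, |w v| * B := hs'.abs.tsum_le_tsum hle hs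
    _ = (∑' v, |w v|) * B := tsum_mul_right

/-- [folklore] Additivity of the coarse superposition (absolutely summable weights, uniformly bounded families). -/
theorem cwsum_add {w : (Fin (d + 1) → ℤ) → ℝ} (hw : Summable fun v => |w v|) {S T : (Fin (d + 1) → ℤ) → MKer (d + 1) (Fib d)}
    {BS BT : ℝ} (hS : ∀ v x z a b, |S v x z a b| ≤ BS) (hT : ∀ v x z a b, |T v x z a b| ≤ BT) :
    cwsum N w (fun v => S v + T v) = cwsum N w S + cwsum N w T := by
  funext x z a b
  rw [Pi.add_apply, Pi.add_apply, Pi.add_apply, Pi.add_apply, cwsum_apply, cwsum_apply, cwsum_apply]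
  have hs : ∀ (R : (Fin (d + 1) → ℤ) → MKer (d + 1) (Fib d)) (BR : ℝ), (∀ v x z a b, |R v x z a b| ≤ BR) →
      Summable fun v => w v * R v x z a b := fun R BR hR =>
    Summable.of_norm_bounded (hw.mul_right BR) (fun v => by
      rw [Real.norm_eq_abs, abs_mul]; exact mul_le_mul_of_nonneg_left (hR v x z a b) (abs_nonneg _))
  rw [← (hs S BS hS).tsum_add (hs T BT hT)]
  exact tsum_congr fun v => by simp only [Pi.add_apply]; ring

/-- [folklore] Subtractivity of the coarse superposition. -/
theorem cwsum_sub {w : (Fin (d + 1) → ℤ) → ℝ} (hw : Summable fun v => |w v|) {S T : (Fin (d + 1) → ℤ) → MKer (d + 1) (Fib d)}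
    {BS BT : ℝ} (hS : ∀ v x z a b, |S v x z a b| ≤ BS) (hT : ∀ v x z a b, |T v x z a b| ≤ BT) :
    cwsum N w (fun v => S v - T v) = cwsum N w S - cwsum N w T := by
  funext x z a b
  rw [Pi.sub_apply, Pi.sub_apply, Pi.sub_apply, Pi.sub_apply, cwsum_apply, cwsum_apply, cwsum_apply]
  have hs : ∀ (R : (Fin (d + 1) → ℤ) → MKer (d + 1) (Fib d)) (BR : ℝ), (∀ v x z a b, |R v x z a b| ≤ BR) →
      Summable fun v => w v * R v x z a b := fun R BR hR =>
    Summable.of_norm_bounded (hw.mul_right BR) (fun v => by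
      rw [Real.norm_eq_abs, abs_mul]; exact mul_le_mul_of_nonneg_left (hR v x z a b) (abs_nonneg _))
  rw [← (hs S BS hS).tsum_sub (hs T BT hT)]
  exact tsum_congr fun v => by simp only [Pi.sub_apply]; ring

/-- [folklore] EXCHANGE `X ∘ (Σ'_v w_v Q_v) = Σ'_v w_v (X ∘ Q_v)` for a spread `X`, absolutely summable coarse weights and a uniformly
bounded family (the coarse twin of an1's `ChartConjugationReflection.comp_wsum`). -/
theorem comp_cwsum {X : MKer (d + 1) (Fib d)} {w : (Fin (d + 1) → ℤ) → ℝ} {Q : (Fin (d + 1) → ℤ) → MKer (d + 1) (Fib d)}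
    (hX : Spr X) (hw : Summable fun v => |w v|) {B : ℝ} (hB0 : 0 ≤ B) (hB : ∀ v x z a b, |Q v x z a b| ≤ B) :
    comp X (cwsum N w Q) = cwsum N w (fun v => comp X (Q v)) := by
  obtain ⟨CM, δ, hδ, hMd⟩ := hX
  funext x z a b
  rw [cwsum_apply]
  simp only [ExpKernelCalculus.comp, cwsum_apply]
  have hs : ∀ y f, Summable fun v => X x y a f * (w v * Q v y z f b) := fun y f => by
    refine Summable.of_norm_bounded ((hw.mul_left (|X x y a f| * B))) (fun v => ?_)
    rw [Real.norm_eq_abs, abs_mul, abs_mul]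
    calc |X x y a f| * (|w v| * |Q v y z f b|) ≤ |X x y a f| * (|w v| * B) :=
          mul_le_mul_of_nonneg_left (mul_le_mul_of_nonneg_left (hB v y z f b) (abs_nonneg _)) (abs_nonneg _)
      _ = |X x y a f| * B * |w v| := by ring
  have step1 : (fun y => ∑ f, X x y a f * ∑' v, w v * Q v y z f b) = fun y => ∑' v, ∑ f, X x y a f * (w v * Q v y z f b) := by
    funext y
    rw [Summable.tsum_finsetSum (fun f _ => hs y f)]
    exact Finset.sum_congr rfl fun f _ => tsum_mul_left.symm
  have hPB : KernelWard.ProdBound (fun y v => ∑ f, X x y a f * (w v * Q v y z f b)) := by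
    refine ⟨fun y => ((Fintype.card (Fib d) : ℝ) * |CM| * B) * Real.exp (-δ * l1 (x - y)), fun v => |w v|,
      (summable_exp_shift hδ x).mul_left _, hw, fun y => by positivity, fun v => abs_nonneg _, fun y v => ?_⟩
    calc |∑ f, X x y a f * (w v * Q v y z f b)| ≤ ∑ f, |X x y a f * (w v * Q v y z f b)| := Finset.abs_sum_le_sum_abs _ _
      _ ≤ ∑ _f : Fib d, |CM| * Real.exp (-δ * l1 (x - y)) * B * |w v| := Finset.sum_le_sum fun f _ => by
          rw [abs_mul, abs_mul]
          have h1 : |X x y a f| ≤ |CM| * Real.exp (-δ * l1 (x - y)) :=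
            (hMd x y a f).trans (mul_le_mul_of_nonneg_right (le_abs_self _) (Real.exp_pos _).le)
          calc |X x y a f| * (|w v| * |Q v y z f b|) ≤ (|CM| * Real.exp (-δ * l1 (x - y))) * (|w v| * B) :=
                mul_le_mul h1 (mul_le_mul_of_nonneg_left (hB v y z f b) (abs_nonneg _)) (by positivity) (by positivity)
            _ = _ := by ring
      _ = ((Fintype.card (Fib d) : ℝ) * |CM| * B) * Real.exp (-δ * l1 (x - y)) * |w v| := by
          rw [Finset.sum_const, Finset.card_univ, nsmul_eq_mul]; ring
  rw [step1, KernelWard.tsum_comm_of_prodBound hPB]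
  refine tsum_congr fun v => ?_
  rw [← tsum_mul_left]
  refine tsum_congr fun y => ?_
  rw [Finset.mul_sum]
  exact Finset.sum_congr rfl fun f _ => by ring

/-- [folklore] EXCHANGE `(Σ'_v w_v Q_v) ∘ X = Σ'_v w_v (Q_v ∘ X)` (by transposition from `comp_cwsum`). -/
theorem cwsum_comp {X : MKer (d + 1) (Fib d)} {w : (Fin (d + 1) → ℤ) → ℝ} {Q : (Fin (d + 1) → ℤ) → MKer (d + 1) (Fib d)}
    (hX : Spr X) (hw : Summable fun v => |w v|) {B : ℝ} (hB0 : 0 ≤ B) (hB : ∀ v x z a b, |Q v x z a b| ≤ B) :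
    comp (cwsum N w Q) X = cwsum N w (fun v => comp (Q v) X) := by
  have h := comp_cwsum (N := N) (Q := fun v => trK (Q v)) hX.trK hw hB0 (fun v x z a b => hB v z x b a)
  have h1 : cwsum N w (fun v => trK (Q v)) = trK (cwsum N w Q) := (trK_cwsum N w Q).symm
  have h2 : (fun v => comp (trK X) (trK (Q v))) = fun v => trK (comp (Q v) X) := funext fun v => by rw [trK_comp]
  have h3 : cwsum N w (fun v => trK (comp (Q v) X)) = trK (cwsum N w (fun v => comp (Q v) X)) := (trK_cwsum N w _).symm
  rw [h1, ← trK_comp, h2, h3] at h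
  have h' := congrArg trK h
  rwa [trK_trK, trK_trK] at h'

end Exchange

/-! ## §2 Linearity of the multiplier-column vertex in its table; the vertex of a conjugated multiplier-row family -/

section VertexM

variable [NeZero N]

/-- [folklore] ADDITIVITY OF THE MULTIPLIER-COLUMN VERTEX in its table (decaying `K`, uniformly bounded tables). -/
theorem vertexOfM_add {K : MKer (d + 1) (Fib d)} (hK : ∃ δ C : ℝ, 0 < δ ∧ 0 ≤ C ∧ Decays K C δ)
    {A B : Fin (d + 1) → (Fin (d + 1) → ℤ) → MKer (d + 1) (Fib d)} {BA BB : ℝ} (hA : ∀ ρ w x z a b, |A ρ w x z a b| ≤ BA)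
    (hB : ∀ ρ w x z a b, |B ρ w x z a b| ≤ BB) (μ : Fin (d + 1)) (y : Fin (d + 1) → ℤ) :
    vertexOfM K N (fun ρ w => A ρ w + B ρ w) μ y = vertexOfM K N A μ y + vertexOfM K N B μ y := by
  -- the vertex as a finite sum of coarse superpositions, kernel-valued (leaf-01's `D1BFx.Criticality.vertexOfM_eq_sum`, inlined)
  have e : ∀ T : Fin (d + 1) → (Fin (d + 1) → ℤ) → MKer (d + 1) (Fib d), vertexOfM K N T μ y = ∑ ρ, cwsum N (colM K N μ y ρ) (T ρ) :=
    fun T => by funext x z a b; simp only [vertexOfM, Finset.sum_apply]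
  rw [e (fun ρ w => A ρ w + B ρ w), e A, e B, ← Finset.sum_add_distrib]
  refine Finset.sum_congr rfl fun ρ _ => ?_
  exact cwsum_add (summable_abs_colM (N := N) hK μ y ρ) (hA ρ) (hB ρ)

/-- [folklore] The multiplier-column vertex of the negated table. -/
theorem vertexOfM_neg (K : MKer (d + 1) (Fib d)) (M : Fin (d + 1) → (Fin (d + 1) → ℤ) → MKer (d + 1) (Fib d)) (μ : Fin (d + 1))
    (y : Fin (d + 1) → ℤ) : vertexOfM K N (fun ρ w => -M ρ w) μ y = -vertexOfM K N M μ y := by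
  funext x z a b
  simp only [vertexOfM, cwsum_apply, Pi.neg_apply, mul_neg, tsum_neg, Finset.sum_neg_distrib]

/-- [folklore] A scalar passes inside the multiplier-column vertex (entrywise; no summability needed). -/
theorem smul_vertexOfM (c : ℝ) (K : MKer (d + 1) (Fib d)) (M : Fin (d + 1) → (Fin (d + 1) → ℤ) → MKer (d + 1) (Fib d))
    (μ : Fin (d + 1)) (y : Fin (d + 1) → ℤ) : c • vertexOfM K N M μ y = vertexOfM K N (fun ρ w => c • M ρ w) μ y := by
  funext x z a b
  simp only [Pi.smul_apply, smul_eq_mul, vertexOfM, cwsum_apply]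
  rw [Finset.mul_sum]
  refine Finset.sum_congr rfl fun ρ _ => ?_
  rw [← tsum_mul_left]
  exact tsum_congr fun w => by ring

omit [NeZero N] in
/-- [folklore] The multiplier-column vertex only sees its table: pointwise-equal tables give the same vertex. -/
theorem vertexOfM_congr (K : MKer (d + 1) (Fib d)) {A B : Fin (d + 1) → (Fin (d + 1) → ℤ) → MKer (d + 1) (Fib d)}
    (h : ∀ ρ w, A ρ w = B ρ w) (μ : Fin (d + 1)) (y : Fin (d + 1) → ℤ) : vertexOfM K N A μ y = vertexOfM K N B μ y := by
  have : A = B := funext fun ρ => funext fun w => h ρ w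
  rw [this]

/-- [folklore] **THE BLOCK PURE-GAUGE CONTRACTION PASSES INSIDE THE MULTIPLIER-COLUMN VERTEX**: for a decaying `K` and a mixed table
`M₂` with a uniform entry bound, the block sum of coarse divergences (in the FIRST, field, slot) of the dressed tables
`T κ u := vertexOfM K N (M₂ κ u) ν y′` is the multiplier-column vertex of the block-contracted table:
`Σ_{v ∈ box} divV T (N•y + v) = vertexOfM K N (fun ρ w ↦ Σ_{v ∈ box} divV (fun κ u ↦ M₂ κ u ρ w) (N•y + v)) ν y′`. -/
theorem sum_divV_vertexOfM_eq {K : MKer (d + 1) (Fib d)} (hK : ∃ δ C : ℝ, 0 < δ ∧ 0 ≤ C ∧ Decays K C δ)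
    {M₂ : Fin (d + 1) → (Fin (d + 1) → ℤ) → Fin (d + 1) → (Fin (d + 1) → ℤ) → MKer (d + 1) (Fib d)} {B₂ : ℝ}
    (hB₂ : ∀ κ u ρ w x z a b, |M₂ κ u ρ w x z a b| ≤ B₂) (y : Fin (d + 1) → ℤ) (ν : Fin (d + 1)) (y' : Fin (d + 1) → ℤ) :
    ∑ v ∈ box (d + 1) N, divV (fun κ u => vertexOfM K N (M₂ κ u) ν y') ((N : ℤ) • y + toSite v) =
      vertexOfM K N (fun ρ w => ∑ v ∈ box (d + 1) N, divV (fun κ u => M₂ κ u ρ w) ((N : ℤ) • y + toSite v)) ν y' := by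
  have hs : ∀ (κ : Fin (d + 1)) (u : Fin (d + 1) → ℤ) (ρ : Fin (d + 1)) (x z : Fin (d + 1) → ℤ) (a b : Fib d),
      Summable fun w => colM K N ν y' ρ w * M₂ κ u ρ w x z a b := fun κ u ρ x z a b =>
    Summable.of_norm_bounded ((summable_abs_colM (N := N) hK ν y' ρ).mul_right B₂) (fun w => by
      rw [Real.norm_eq_abs, abs_mul]; exact mul_le_mul_of_nonneg_left (hB₂ κ u ρ w x z a b) (abs_nonneg _))
  funext x z a b
  simp only [Finset.sum_apply, KernelWard.divV, Pi.sub_apply, vertexOfM, cwsum_apply]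
  have e : ∀ ρ : Fin (d + 1), (∑' w, colM K N ν y' ρ w *
      ∑ v ∈ box (d + 1) N, ∑ κ₁, (M₂ κ₁ ((N : ℤ) • y + toSite v - unitVec κ₁) ρ w x z a b - M₂ κ₁ ((N : ℤ) • y + toSite v) ρ w x z a b))
      = ∑ v ∈ box (d + 1) N, ∑ κ₁, ((∑' w, colM K N ν y' ρ w * M₂ κ₁ ((N : ℤ) • y + toSite v - unitVec κ₁) ρ w x z a b) -
          ∑' w, colM K N ν y' ρ w * M₂ κ₁ ((N : ℤ) • y + toSite v) ρ w x z a b) := by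
    intro ρ
    have h1 : ∀ w, colM K N ν y' ρ w *
        ∑ v ∈ box (d + 1) N, ∑ κ₁, (M₂ κ₁ ((N : ℤ) • y + toSite v - unitVec κ₁) ρ w x z a b - M₂ κ₁ ((N : ℤ) • y + toSite v) ρ w x z a b)
        = ∑ v ∈ box (d + 1) N, ∑ κ₁, (colM K N ν y' ρ w * M₂ κ₁ ((N : ℤ) • y + toSite v - unitVec κ₁) ρ w x z a b -
            colM K N ν y' ρ w * M₂ κ₁ ((N : ℤ) • y + toSite v) ρ w x z a b) := fun w => by
      rw [Finset.mul_sum]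
      refine Finset.sum_congr rfl fun v _ => ?_
      rw [Finset.mul_sum]
      exact Finset.sum_congr rfl fun κ₁ _ => by ring
    simp only [h1]
    rw [Summable.tsum_finsetSum (fun v _ => summable_sum fun κ₁ _ => (hs κ₁ _ ρ x z a b).sub (hs κ₁ _ ρ x z a b))]
    refine Finset.sum_congr rfl fun v _ => ?_
    rw [Summable.tsum_finsetSum (fun κ₁ _ => (hs κ₁ _ ρ x z a b).sub (hs κ₁ _ ρ x z a b))]
    refine Finset.sum_congr rfl fun κ₁ _ => ?_
    exact (hs κ₁ _ ρ x z a b).tsum_sub (hs κ₁ _ ρ x z a b)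
  simp only [e]
  symm
  rw [Finset.sum_comm]
  refine Finset.sum_congr rfl fun v _ => ?_
  rw [Finset.sum_comm]
  refine Finset.sum_congr rfl fun κ₁ _ => ?_
  rw [Finset.sum_sub_distrib]

/-- [folklore] **THE MULTIPLIER-COLUMN VERTEX OF A CONJUGATED MULTIPLIER-ROW FAMILY IS THE CONJUGATE OF THE VERTEX**:
`vertexOfM K N (ρ w ↦ conjV X (M ρ w)) μ y = conjV X (vertexOfM K N M μ y)` (decaying `K`, spread `X`, uniformly bounded `M`; two exchanges
of absolutely convergent sums and the additivity of `X ∘ ·`, `· ∘ X` over bounded kernels). -/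
theorem vertexOfM_conjV {K X : MKer (d + 1) (Fib d)} (hK : ∃ δ C : ℝ, 0 < δ ∧ 0 ≤ C ∧ Decays K C δ) (hX : Spr X)
    {M : Fin (d + 1) → (Fin (d + 1) → ℤ) → MKer (d + 1) (Fib d)} {B : ℝ} (hB : ∀ ρ w x z a b, |M ρ w x z a b| ≤ B)
    (μ : Fin (d + 1)) (y : Fin (d + 1) → ℤ) :
    vertexOfM K N (fun ρ w => conjV X (M ρ w)) μ y = conjV X (vertexOfM K N M μ y) := by
  obtain ⟨CX, δX, hδX, hXd⟩ := id hX
  have hB0 : 0 ≤ B := (abs_nonneg _).trans (hB 0 0 0 0 (Sum.inl 0) (Sum.inl 0))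
  -- uniform bounds: `X ∘ M ρ w`, `M ρ w ∘ X` by the (ρ, w)-independent constant; each coarse superposition by `(Σ'|colM|)·B`
  set BX : ℝ := (Fintype.card (Fib d) : ℝ) * CX * Zl (d + 1) δX * B with hBX
  have hXM : ∀ ρ w x z a b, |comp X (M ρ w) x z a b| ≤ BX := fun ρ w => abs_comp_le_of_spr_left hXd hδX (hB ρ w)
  have hMX : ∀ ρ w x z a b, |comp (M ρ w) X x z a b| ≤ BX := fun ρ w => abs_comp_le_of_spr_right hXd hδX (hB ρ w)
  have hC : ∀ ρ x z a b, |cwsum N (colM K N μ y ρ) (M ρ) x z a b| ≤ (∑' w, |colM K N μ y ρ w|) * B := fun ρ =>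
    abs_cwsum_le (summable_abs_colM (N := N) hK μ y ρ) (hB ρ)
  -- termwise in the multiplier slot `ρ`
  have e : ∀ ρ, cwsum N (colM K N μ y ρ) (fun w => conjV X (M ρ w)) = conjV X (cwsum N (colM K N μ y ρ) (M ρ)) := fun ρ => by
    unfold ChartConjugation.conjV
    rw [cwsum_sub (summable_abs_colM (N := N) hK μ y ρ) (hXM ρ) (hMX ρ),
      comp_cwsum hX (summable_abs_colM (N := N) hK μ y ρ) hB0 (hB ρ), cwsum_comp hX (summable_abs_colM (N := N) hK μ y ρ) hB0 (hB ρ)]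
  have eVS : ∀ T : Fin (d + 1) → (Fin (d + 1) → ℤ) → MKer (d + 1) (Fib d), vertexOfM K N T μ y = ∑ ρ, cwsum N (colM K N μ y ρ) (T ρ) :=
    fun T => by funext x z a b; simp only [vertexOfM, Finset.sum_apply]
  rw [eVS (fun ρ w => conjV X (M ρ w)), eVS M]
  simp only [e]
  -- the conjugation through the finite multiplier-slot sum
  unfold ChartConjugation.conjV
  rw [Finset.sum_sub_distrib]
  have hsum : ∀ (s : Finset (Fin (d + 1))), comp X (∑ ρ ∈ s, cwsum N (colM K N μ y ρ) (M ρ)) = ∑ ρ ∈ s, comp X (cwsum N (colM K N μ y ρ) (M ρ))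
      ∧ comp (∑ ρ ∈ s, cwsum N (colM K N μ y ρ) (M ρ)) X = ∑ ρ ∈ s, comp (cwsum N (colM K N μ y ρ) (M ρ)) X
      ∧ ∀ x z a b, |(∑ ρ ∈ s, cwsum N (colM K N μ y ρ) (M ρ)) x z a b| ≤ ∑ ρ ∈ s, (∑' w, |colM K N μ y ρ w|) * B := by
    intro s
    induction s using Finset.induction_on with
    | empty =>
      refine ⟨?_, ?_, fun x z a b => by simp⟩
      · funext x z a b; simp [ExpKernelCalculus.comp]
      · funext x z a b; simp [ExpKernelCalculus.comp]
    | insert ρ s hρ ih =>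
      obtain ⟨ih1, ih2, ih3⟩ := ih
      rw [Finset.sum_insert hρ, Finset.sum_insert hρ, Finset.sum_insert hρ, Finset.sum_insert hρ]
      refine ⟨?_, ?_, fun x z a b => ?_⟩
      · rw [comp_add_of_bdd hX (hC ρ) ih3, ih1]
      · rw [add_comp_of_bdd hX (hC ρ) ih3, ih2]
      · rw [Pi.add_apply, Pi.add_apply, Pi.add_apply, Pi.add_apply]
        exact (abs_add_le _ _).trans (add_le_add (hC ρ x z a b) (ih3 x z a b))
  obtain ⟨h1, h2, -⟩ := hsum Finset.univ
  rw [h1, h2]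

end VertexM

end Summit.QuantumFields.BalabanUV.Beta.KernelWardCoarseExchange

end
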